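import Literature.NumberTheory.EllipticCurves.IwasawaAlgebraEisensteinResidualInvolution
import Literature.NumberTheory.EllipticCurves.ZpExtensionEisensteinTwistDualityForm
import Literature.NumberTheory.GaloisCohomology.Howard2004.TransportStrictKernelProofs
import Literature.NumberTheory.GaloisCohomology.Howard2004.TransportConnectingKernelProofs
import Literature.NumberTheory.GaloisCohomology.Howard2004.CohomologyMapBijectiveTransportProofs
import Literature.NumberTheory.EllipticCurves.ZpExtensionEisensteinDVRSettingH4FbarProofs
import Literature.NumberTheory.EllipticCurves.ZpExtensionEisensteinSelmerStructureProofs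
import Literature.NumberTheory.GaloisCohomology.Howard2004.PropagateUnramifiedProofs
import HarnessLib

/-!
# The `G_ℚ`-structure `Θ₁ = ι₁ ⊗ τ` of the bottom Eisenstein level `E[p] ⊗ A_{m,1}(ψ)` and the transport of the
# torsion cut at a place above `p` (theorems only; no definition, no named fact, no instance, no `sorry`)

Topic `NumberTheory/EllipticCurves` (D1 road of cell `pub/bsd-print-x9`; brick (H5B-P-ANOM) of `Stmt.h5bAtS`, road «uniform
involution», file F5 of the design of seat `bsd-line-x9-p1-w3` g6).

B. Howard, *The Heegner point Kolyvagin system*, Compositio Math. 140 (2004), H.5 (arXiv:1202.6340 p. 7 L93–97, L108–113): the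
`G_K`-action on `T_𝔮 = T_p E ⊗ S_𝔮(ψ)` does NOT extend to `G_ℚ` (`Tw(T_𝔮) ≅ T_{ι𝔮} ≠ T_𝔮`), but on the bottom level
`W₁ = T_𝔮/p = E[p] ⊗ A_{m,1}(ψ)` with the characteristic-`p` coefficient ring `A_{m,1} = 𝔽_p[T]/(T^m)` the Iwasawa involution
`ι₁ : T ↦ (1+T)⁻¹ − 1` acts (x10b-p1-w6 `IwasawaAlgebra.EisensteinCoeff.invol₁`, p668913) with `ι₁(ψ(g)) = ψ(g)⁻¹ = ψ(τ g τ⁻¹)`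
(`κ` anticyclotomic), so that

  **`Θ₁ := ι₁ ⊗ τ : Tw(W₁) → W₁`** (`Θ₁ (d ⊗ a) = ι₁ d ⊗ τ a`)

is a `Γ_K`-EQUIVARIANT `ι₁`-semilinear additive involution extending the residual `G_ℚ`-structure `θ = τ_*` of H.5(a) on `T̄ = E[p]`
(`residualTauGeomTorsion`).  This file proves, for a conjugation datum `cd` and `κ` anticyclotomic for `cd.conj`:

* §1 `exists_residualInvol`: existence of `Θ₁` with `Θ₁ (d ⊗ a) = ι₁ d ⊗ τ a` (Mathlib `TensorProduct.map`), and from this formula: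
  `ι₁`-semilinearity, `cd.conj`-equivariance (`residualInvol_compat`, anticyclotomicity enters through
  `twistExponent_add_twistExponent_conj_dvd` and `invol₁_onePlusT_pow_eq'`), involutivity;
* §2 the induced bijection `Ψ_v := H¹(Θ₁) ∘ transport_v : H¹(K_{σv}, W₁) → H¹(K_v, W₁)` (`ResidualTau.thetaH1`, R := ℤ):
  bijectivity, `Ψ_v ∘ H¹(d •) = H¹(ι₁ d •) ∘ Ψ_v` (`thetaH1_transportH1_scalarMapH1`), and, for the canonical datum
  `ConjugationDatum.ofLifts` and the ordinary plus parts `Fil_w W₁ = A ⊗ Fil_w E[p]` (`ordinaryFiltrationAt`):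
  `Ψ_v (H¹_str(K_{σv}, Fil_{σv} W₁)) = H¹_str(K_v, Fil_v W₁)` (x9-p1-w3 g5's `ResidualTau.map_thetaH1_comp_transportH1_strictSubgroup_eq`
  with `τ δ_v (Fil_{σv} E[p]) = Fil_v E[p]`), hence — `ι₁ [T]^r = u^r [T]^r` for a unit `u` and `H¹_str` an `A_{m,1}`-submodule —
  **`map_thetaH1_transportH1_torsionCut_eq`**: `Ψ_v` carries the TORSION CUT `{y : [T]^r · y ∈ H¹_str(K_{σv}, Fil_{σv} W₁)}`
  onto `{y : [T]^r · y ∈ H¹_str(K_v, Fil_v W₁)}`;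
* §3 compatibility with the residual presentation: `π̄ ∘ Θ₁ = θ ∘ π̄` for any `π̄ : W₁ → E[p]` with `π̄ (d ⊗ a) = ε(d) · a`
  (`residueChar_invol₁_eq`), whence `H¹(π̄) ∘ Ψ_v = (θ_v ∘ transport_v) ∘ H¹(π̄)` on `H¹(K_{σv}, W₁)`
  (`ConjugationDatum.transportH1_map_localMap`).

Together with the cell's `TowerTorsionCutProofs` / `TowerTorsionCutPresentedProofs` (the residual image of Howard's `F_𝔮` at `w ∣ p`
IS the image of the torsion cut for `m ≫ 0`) this gives H.5(b) at the places above `p` without any anomalous/non-anomalous case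
distinction.  No summit statement is proved; BSD is not proved by any of this.

References: [Howard2004HeegnerKolyvagin] §1.3 H.5 (arXiv p. 7 L93–97, L108–113), §2.2, §3.2 (ψ : T_𝔭 → T_{𝔭^ι}, p. 16 L116–123);
[MazurTateTeitelbaum1986Invent] Ch. I §17; [SerreGaloisCohomology1997] I §2.2, §2.4, §5.8; [GreenbergLNM1716] §2.
-/

set_option autoImplicit false

noncomputable section

open Function NumberField IsDedekindDomain Field
open scoped NumberField TensorProduct ContRepresentation

namespace WeierstrassCurve

open Literature.NumberTheory.EllipticCurves Literature.NumberTheory.GaloisRepresentations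
open Literature.NumberTheory.GaloisRepresentations.DiscreteGaloisModule
open Literature.NumberTheory.GaloisCohomology.Howard2004
open Literature.NumberTheory.EllipticCurves.IwasawaAlgebra Literature.NumberTheory.EllipticCurves.ZpExtension

variable {K : Type} [Field K] [NumberField K] (W : WeierstrassCurve ℚ) {p : ℕ} [hp : Fact p.Prime]
  (κ : ZpExtension K p) {m : ℕ} (hm : 1 ≤ m) (cd : ConjugationDatum K)

/-! ## §1 `Θ₁ = ι₁ ⊗ τ` on `W₁ = E[p] ⊗ A_{m,1}(ψ)` -/

/-- **Existence of `Θ₁ = ι₁ ⊗ τ`** on `E_K[p] ⊗ A_{m,1}`: an additive endomorphism with `Θ₁ (d ⊗ a) = ι₁ d ⊗ τ a`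
(Mathlib `TensorProduct.map` of `invol₁` and the action `torsionMap` of the lift `τ` on `E[p]`).
[cite: Howard2004HeegnerKolyvagin, §1.3 H.5(a) (arXiv p. 7 L93–95) and §3.2 (p. 16 L116–123: ψ(t ⊗ α) = t^τ ⊗ α^ι)]
[cite: MazurTateTeitelbaum1986Invent, Ch. I §17] -/
theorem exists_residualInvol :
    ∃ Θ : EisensteinCoeff.Twisted p m 1 (geomTorsion (W.baseChange K) ((p : ℤ) ^ 1)) →+
        EisensteinCoeff.Twisted p m 1 (geomTorsion (W.baseChange K) ((p : ℤ) ^ 1)),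
      ∀ (d : EisensteinCoeff p m 1) (a : geomTorsion (W.baseChange K) ((p : ℤ) ^ 1)),
        Θ (EisensteinCoeff.Twisted.tmul d a) =
          EisensteinCoeff.Twisted.tmul (EisensteinCoeff.invol₁ p m d) (cd.isLift.torsionMap W ((p : ℤ) ^ 1) a) :=
  ⟨(TensorProduct.map (EisensteinCoeff.invol₁ p m).toAddMonoidHom.toIntLinearMap
      (cd.isLift.torsionMap W ((p : ℤ) ^ 1)).toIntLinearMap).toAddMonoidHom,
    fun d a ↦ TensorProduct.map_tmul _ _ d a⟩

variable {Θ : EisensteinCoeff.Twisted p m 1 (geomTorsion (W.baseChange K) ((p : ℤ) ^ 1)) →+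
    EisensteinCoeff.Twisted p m 1 (geomTorsion (W.baseChange K) ((p : ℤ) ^ 1))}
  (hΘ : ∀ (d : EisensteinCoeff p m 1) (a : geomTorsion (W.baseChange K) ((p : ℤ) ^ 1)),
    Θ (EisensteinCoeff.Twisted.tmul d a) =
      EisensteinCoeff.Twisted.tmul (EisensteinCoeff.invol₁ p m d) (cd.isLift.torsionMap W ((p : ℤ) ^ 1) a))

include hΘ in
/-- **`Θ₁` is `ι₁`-semilinear**: `Θ₁ (d • x) = ι₁ d • Θ₁ x`. [cite: Howard2004HeegnerKolyvagin, §3.2 (arXiv p. 16 L116–123: ψ is ι-semilinear)] -/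
theorem residualInvol_smul (d : EisensteinCoeff p m 1)
    (x : EisensteinCoeff.Twisted p m 1 (geomTorsion (W.baseChange K) ((p : ℤ) ^ 1))) :
    Θ (d • x) = EisensteinCoeff.invol₁ p m d • Θ x := by
  induction x using EisensteinCoeff.Twisted.induction_on with
  | zero => rw [smul_zero, map_zero, smul_zero]
  | tmul d' a => rw [EisensteinCoeff.Twisted.smul_tmul, hΘ, hΘ, map_mul, EisensteinCoeff.Twisted.smul_tmul]
  | add x y hx hy => rw [smul_add, map_add, hx, hy, map_add, smul_add]

include hΘ in
/-- **`Θ₁` is an involution** (`ι₁` and `τ` are). [cite: Howard2004HeegnerKolyvagin, §1.3 H.5(a) (arXiv p. 7 L93–95)] -/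
theorem residualInvol_involutive (hτ₂ : Function.Involutive cd.τ)
    (x : EisensteinCoeff.Twisted p m 1 (geomTorsion (W.baseChange K) ((p : ℤ) ^ 1))) : Θ (Θ x) = x := by
  induction x using EisensteinCoeff.Twisted.induction_on with
  | zero => rw [map_zero, map_zero]
  | tmul d a =>
    rw [hΘ, hΘ, EisensteinCoeff.invol₁_involutive p m d, cd.isLift.torsionMap_torsionMap W hτ₂ _ a]
  | add x y hx hy => rw [map_add, map_add, hx, hy]

include hΘ in
/-- **`Θ₁` intertwines the `τ`-conjugate of the twisted action with the twisted action**: for `κ` anticyclotomic with respect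
to `cd.conj` (`κ(τ⁻¹ g τ) = −κ(g)`), `Θ₁ (ρ₁ (cd.conj g) x) = ρ₁ g (Θ₁ x)` — on pure tensors the unipotent factors match because
`ι₁((1+T)^{e(τ⁻¹gτ)}) = (1+T)^{e(g)}`. [cite: Howard2004HeegnerKolyvagin, §1.3 H.5 (arXiv p. 7 L93–97, L108–113) and §2.2 (anticyclotomic ψ)]
[cite: MazurTateTeitelbaum1986Invent, Ch. I §17] -/
theorem residualInvol_compat (hanti : ∀ g : absoluteGaloisGroup K, (κ (cd.conj g)).toAdd = -(κ g).toAdd)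
    (g : absoluteGaloisGroup K) (x : EisensteinCoeff.Twisted p m 1 (geomTorsion (W.baseChange K) ((p : ℤ) ^ 1))) :
    Θ (κ.eisensteinTwist ((W.baseChange K).torsionGaloisModule ((p : ℤ) ^ 1)) hm 1 (cd.conj g) x) =
      κ.eisensteinTwist ((W.baseChange K).torsionGaloisModule ((p : ℤ) ^ 1)) hm 1 g (Θ x) := by
  have hu : EisensteinCoeff.invol₁ p m (EisensteinCoeff.onePlusT p m 1) ^
        κ.twistExponent (eisensteinLevel (p := p) hm 1) (cd.conj g) =
      EisensteinCoeff.onePlusT p m 1 ^ κ.twistExponent (eisensteinLevel (p := p) hm 1) g := by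
    refine EisensteinCoeff.invol₁_onePlusT_pow_eq' p m ?_
    obtain ⟨n, hn⟩ := twistExponent_add_twistExponent_conj_dvd κ cd.conj hanti (eisensteinLevel (p := p) hm 1) g
    rw [← pow_add, hn, pow_mul, onePlusT_pow_prime_pow_eisensteinLevel, one_pow]
  have hθ : ∀ a : geomTorsion (W.baseChange K) ((p : ℤ) ^ 1),
      cd.isLift.torsionMap W ((p : ℤ) ^ 1) (((W.baseChange K).torsionGaloisModule ((p : ℤ) ^ 1)) (cd.conj g) a) =
        ((W.baseChange K).torsionGaloisModule ((p : ℤ) ^ 1)) g (cd.isLift.torsionMap W ((p : ℤ) ^ 1) a) := fun a ↦ by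
    rw [torsionGaloisModule_apply_apply, torsionGaloisModule_apply_apply]
    exact cd.isLift.torsionMap_smul W ((p : ℤ) ^ 1) g a
  induction x using EisensteinCoeff.Twisted.induction_on with
  | zero => rw [map_zero, map_zero, map_zero]
  | tmul d a =>
    have hud : EisensteinCoeff.invol₁ p m
        (EisensteinCoeff.onePlusT p m 1 ^ κ.twistExponent (eisensteinLevel (p := p) hm 1) (cd.conj g) * d) =
        EisensteinCoeff.onePlusT p m 1 ^ κ.twistExponent (eisensteinLevel (p := p) hm 1) g * EisensteinCoeff.invol₁ p m d := by
      rw [map_mul, ← hu]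
      exact congrArg (· * _) (RingHom.map_pow (EisensteinCoeff.invol₁ p m) _ _)
    rw [eisensteinTwist_apply_tmul, hΘ, hΘ, eisensteinTwist_apply_tmul, hud, hθ]
  | add x y hx hy => rw [map_add, map_add, hx, hy, map_add, map_add]

/-! ## §2 The induced bijection `Ψ_v = H¹(Θ₁) ∘ transport_v` on `H¹(K_•, W₁)` -/

variable (hτ₂ : Function.Involutive cd.τ) (hanti : ∀ g : absoluteGaloisGroup K, (κ (cd.conj g)).toAdd = -(κ g).toAdd)

include hΘ hanti in
/-- The equivariance of `Θ₁` read at a place `v`: `Θ₁ (Tw(W₁)|_{Γ_{K_v}} g x) = W₁|_{Γ_{K_v}} g (Θ₁ x)` (the hypothesis of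
`ContinuousRep.cohomologyMap` for `H¹(Θ₁) : H¹(K_v, Tw W₁) → H¹(K_v, W₁)`).
[cite: Howard2004HeegnerKolyvagin, §1.3 H.5 (arXiv p. 7 L93–97)] -/
theorem residualInvol_compat_toLocal (v : HeightOneSpectrum (𝓞 K))
    (g : absoluteGaloisGroup (Place.Completion (Sum.inr v : Place K)))
    (x : EisensteinCoeff.Twisted p m 1 (geomTorsion (W.baseChange K) ((p : ℤ) ^ 1))) :
    Θ (((cd.twist (κ.eisensteinTwist ((W.baseChange K).torsionGaloisModule ((p : ℤ) ^ 1)) hm 1)).toLocal (Sum.inr v)) g x) =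
      ((κ.eisensteinTwist ((W.baseChange K).torsionGaloisModule ((p : ℤ) ^ 1)) hm 1).toLocal (Sum.inr v)) g (Θ x) := by
  rw [DiscreteGaloisModule.toLocal_apply, DiscreteGaloisModule.toLocal_apply, ConjugationDatum.twist_apply]
  exact W.residualInvol_compat κ hm cd hΘ hanti _ x

include hΘ hτ₂ hanti in
/-- **`Ψ_v = H¹(Θ₁) ∘ transport_v` is a bijection `H¹(K_{σv}, W₁) → H¹(K_v, W₁)`** (`transport_v` is bijective, `Θ₁` an
equivariant bijection `Tw(W₁) → W₁`). [cite: Howard2004HeegnerKolyvagin, §1.3 (arXiv p. 7 L44–50, L93–97)] [cite: SerreGaloisCohomology1997, I §2.4] -/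
theorem thetaH1_transportH1_bijective (v : HeightOneSpectrum (𝓞 K)) :
    Function.Bijective
      ((ContinuousRep.cohomologyMap
          ((cd.twist (κ.eisensteinTwist ((W.baseChange K).torsionGaloisModule ((p : ℤ) ^ 1)) hm 1)).toLocal (Sum.inr v))
          ((κ.eisensteinTwist ((W.baseChange K).torsionGaloisModule ((p : ℤ) ^ 1)) hm 1).toLocal (Sum.inr v))
          Θ continuous_of_discreteTopology (W.residualInvol_compat_toLocal κ hm cd hΘ hanti v) 1).comp
        (cd.transportH1 (κ.eisensteinTwist ((W.baseChange K).torsionGaloisModule ((p : ℤ) ^ 1)) hm 1) v)) :=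
  (bijective_cohomologyMap_of_bijective _ _ Θ (W.residualInvol_compat_toLocal κ hm cd hΘ hanti v)
      (Function.Involutive.bijective (W.residualInvol_involutive cd hΘ hτ₂))).comp
    (cd.transportH1_bijective _ v)

include hΘ hanti in
/-- **`Ψ_v` is `ι₁`-semilinear on `H¹`**: `Ψ_v (H¹(d •) y) = H¹(ι₁ d •) (Ψ_v y)` — the transport commutes with the (equivariant)
scalars and `Θ₁` is `ι₁`-semilinear. [cite: Howard2004HeegnerKolyvagin, §1.3 and §3.2 (arXiv p. 7 L44–50; p. 16 L116–123)]
[cite: SerreGaloisCohomology1997, I §2.4 (compatible pairs)] -/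
theorem thetaH1_transportH1_scalarMapH1 (v : HeightOneSpectrum (𝓞 K)) (d : EisensteinCoeff p m 1)
    (y : galoisCohomology ((κ.eisensteinTwist ((W.baseChange K).torsionGaloisModule ((p : ℤ) ^ 1)) hm 1).toLocal
      (Sum.inr (cd.σ • v))) 1) :
    (ContinuousRep.cohomologyMap
          ((cd.twist (κ.eisensteinTwist ((W.baseChange K).torsionGaloisModule ((p : ℤ) ^ 1)) hm 1)).toLocal (Sum.inr v))
          ((κ.eisensteinTwist ((W.baseChange K).torsionGaloisModule ((p : ℤ) ^ 1)) hm 1).toLocal (Sum.inr v))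
          Θ continuous_of_discreteTopology (W.residualInvol_compat_toLocal κ hm cd hΘ hanti v) 1)
        (cd.transportH1 _ v
          (galoisCohomology.scalarMapH1 _
            ((κ.isScalarLinear_eisensteinTwist ((W.baseChange K).torsionGaloisModule ((p : ℤ) ^ 1)) hm 1).restrictField _) d y)) =
      galoisCohomology.scalarMapH1 _
        ((κ.isScalarLinear_eisensteinTwist ((W.baseChange K).torsionGaloisModule ((p : ℤ) ^ 1)) hm 1).restrictField _)
        (EisensteinCoeff.invol₁ p m d)
        (ContinuousRep.cohomologyMap
          ((cd.twist (κ.eisensteinTwist ((W.baseChange K).torsionGaloisModule ((p : ℤ) ^ 1)) hm 1)).toLocal (Sum.inr v))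
          ((κ.eisensteinTwist ((W.baseChange K).torsionGaloisModule ((p : ℤ) ^ 1)) hm 1).toLocal (Sum.inr v))
          Θ continuous_of_discreteTopology (W.residualInvol_compat_toLocal κ hm cd hΘ hanti v) 1
          (cd.transportH1 _ v y)) := by
  have e1 : galoisCohomology.scalarMapH1 _
      ((κ.isScalarLinear_eisensteinTwist ((W.baseChange K).torsionGaloisModule ((p : ℤ) ^ 1)) hm 1).restrictField _) d y =
      galoisCohomology.map (Literature.NumberTheory.EllipticCurves.DiscreteGaloisModule.localMap
        (scalarIntertwining (κ.eisensteinTwist ((W.baseChange K).torsionGaloisModule ((p : ℤ) ^ 1)) hm 1)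
          (κ.isScalarLinear_eisensteinTwist ((W.baseChange K).torsionGaloisModule ((p : ℤ) ^ 1)) hm 1) d)
        (Sum.inr (cd.σ • v))) 1 y :=
    galoisCohomology.map_congr_apply _ _ (fun _ ↦ rfl) y
  have e2 := cd.transportH1_map_localMap (κ.eisensteinTwist ((W.baseChange K).torsionGaloisModule ((p : ℤ) ^ 1)) hm 1)
    (κ.eisensteinTwist ((W.baseChange K).torsionGaloisModule ((p : ℤ) ^ 1)) hm 1)
    (scalarIntertwining (κ.eisensteinTwist ((W.baseChange K).torsionGaloisModule ((p : ℤ) ^ 1)) hm 1)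
      (κ.isScalarLinear_eisensteinTwist ((W.baseChange K).torsionGaloisModule ((p : ℤ) ^ 1)) hm 1) d) v y
  rw [e1, e2]
  -- `H¹(Θ₁)` as `galoisCohomology.map` of the intertwining map `ΘI`
  let ΘI : ((cd.twist (κ.eisensteinTwist ((W.baseChange K).torsionGaloisModule ((p : ℤ) ^ 1)) hm 1)).toLocal
        (Sum.inr v)).toContRepresentation →ⁱL
      ((κ.eisensteinTwist ((W.baseChange K).torsionGaloisModule ((p : ℤ) ^ 1)) hm 1).toLocal (Sum.inr v)).toContRepresentation :=
    { toContinuousLinearMap := ⟨Θ.toIntLinearMap, continuous_of_discreteTopology⟩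
      isIntertwining' := fun g ↦ ContinuousLinearMap.ext fun x ↦ W.residualInvol_compat_toLocal κ hm cd hΘ hanti v g x }
  have hΘI : ContinuousRep.cohomologyMap
      ((cd.twist (κ.eisensteinTwist ((W.baseChange K).torsionGaloisModule ((p : ℤ) ^ 1)) hm 1)).toLocal (Sum.inr v))
      ((κ.eisensteinTwist ((W.baseChange K).torsionGaloisModule ((p : ℤ) ^ 1)) hm 1).toLocal (Sum.inr v))
      Θ continuous_of_discreteTopology (W.residualInvol_compat_toLocal κ hm cd hΘ hanti v) 1 = galoisCohomology.map ΘI 1 :=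
    cohomologyMap_one_eq_map _ _ Θ _ _ ΘI (fun _ ↦ rfl)
  rw [hΘI]
  let sd : ((cd.twist (κ.eisensteinTwist ((W.baseChange K).torsionGaloisModule ((p : ℤ) ^ 1)) hm 1)).toLocal
        (Sum.inr v)).toContRepresentation →ⁱL
      ((cd.twist (κ.eisensteinTwist ((W.baseChange K).torsionGaloisModule ((p : ℤ) ^ 1)) hm 1)).toLocal
        (Sum.inr v)).toContRepresentation :=
    Literature.NumberTheory.EllipticCurves.DiscreteGaloisModule.localMap
      (Literature.NumberTheory.EllipticCurves.DiscreteGaloisModule.restrictMap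
        (scalarIntertwining (κ.eisensteinTwist ((W.baseChange K).torsionGaloisModule ((p : ℤ) ^ 1)) hm 1)
          (κ.isScalarLinear_eisensteinTwist ((W.baseChange K).torsionGaloisModule ((p : ℤ) ^ 1)) hm 1) d) cd.conj)
      (Sum.inr v)
  let sι : ((κ.eisensteinTwist ((W.baseChange K).torsionGaloisModule ((p : ℤ) ^ 1)) hm 1).toLocal
        (Sum.inr v)).toContRepresentation →ⁱL
      ((κ.eisensteinTwist ((W.baseChange K).torsionGaloisModule ((p : ℤ) ^ 1)) hm 1).toLocal (Sum.inr v)).toContRepresentation :=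
    scalarIntertwining _
      ((κ.isScalarLinear_eisensteinTwist ((W.baseChange K).torsionGaloisModule ((p : ℤ) ^ 1)) hm 1).restrictField _)
      (EisensteinCoeff.invol₁ p m d)
  change galoisCohomology.map ΘI 1 (galoisCohomology.map sd 1 _) = galoisCohomology.map sι 1 (galoisCohomology.map ΘI 1 _)
  have hpt : ∀ x, (ΘI.comp sd) x = (sι.comp ΘI) x := fun x ↦ by
    change Θ (d • x) = EisensteinCoeff.invol₁ p m d • Θ x
    exact W.residualInvol_smul cd hΘ d x
  exact (galoisCohomology.map_map_of_comp_apply sd ΘI (ΘI.comp sd) (fun _ ↦ rfl) _).trans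
    ((galoisCohomology.map_congr_apply _ _ hpt _).trans
      (galoisCohomology.map_map_of_comp_apply ΘI sι (sι.comp ΘI) (fun _ ↦ rfl) _).symm)


/-! ## §2b Transport of the strict ordinary conditions `H¹_str(K_•, Fil_• W₁)` -/

include hΘ hτ₂ in
/-- **`x ∈ Fil_{σv} W₁ ↔ Θ₁ (ρ₁(δ_v) x) ∈ Fil_v W₁`** for two ordinary filtrations `Φ₁` (at `σ v`) and `Φ₂` (at `v`) of the
torsion tower of `E` whose bottom plus parts correspond under `a ↦ τ(δ_v a)` (`hFil`; for `ordinaryFiltrationAt`: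
`τ(Fil_{σv} E[p]) = Fil_v E[p]`): on pure tensors `Θ₁ (ρ₁(δ_v)(c ⊗ a)) = ι₁((1+T)^{e} c) ⊗ τ(δ_v a)`, and the inverse map
`ρ₁(δ_v)⁻¹ ∘ Θ₁` has the same shape. [cite: Howard2004HeegnerKolyvagin, §3.1 (arXiv p. 15 L56–62: Fil_v T_𝔮 = Fil_v T ⊗ S_𝔮) and §3.2 (p. 16 L5–6)]
[cite: GreenbergLNM1716, §2] -/
theorem mem_twistedFil_iff_residualInvol_delta_mem (v : HeightOneSpectrum (𝓞 K))
    {t : ∀ k, ((W.baseChange K).torsionGaloisModule ((p : ℤ) ^ (k + 1))).toContRepresentation →ⁱL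
      ((W.baseChange K).torsionGaloisModule ((p : ℤ) ^ k)).toContRepresentation}
    (Φ₁ : ZpExtension.OrdinaryFiltration (fun k ↦ (W.baseChange K).torsionGaloisModule ((p : ℤ) ^ k)) t (cd.σ • v))
    (Φ₂ : ZpExtension.OrdinaryFiltration (fun k ↦ (W.baseChange K).torsionGaloisModule ((p : ℤ) ^ k)) t v)
    (hFil : ∀ a : geomTorsion (W.baseChange K) ((p : ℤ) ^ 1), a ∈ Φ₁.fil 1 ↔
      cd.isLift.torsionMap W ((p : ℤ) ^ 1) (((W.baseChange K).torsionGaloisModule ((p : ℤ) ^ 1)) (cd.δ v) a) ∈ Φ₂.fil 1)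
    (x : EisensteinCoeff.Twisted p m 1 (geomTorsion (W.baseChange K) ((p : ℤ) ^ 1))) :
    x ∈ Φ₁.twistedFil (p := p) (m := m) 1 ↔
      Θ (κ.eisensteinTwist ((W.baseChange K).torsionGaloisModule ((p : ℤ) ^ 1)) hm 1 (cd.δ v) x) ∈
        Φ₂.twistedFil (p := p) (m := m) 1 := by
  have hρρ : ∀ a : geomTorsion (W.baseChange K) ((p : ℤ) ^ 1),
      ((W.baseChange K).torsionGaloisModule ((p : ℤ) ^ 1)) (cd.δ v)
        (((W.baseChange K).torsionGaloisModule ((p : ℤ) ^ 1)) (cd.δ v)⁻¹ a) = a := fun a ↦ by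
    rw [← Module.End.mul_apply, ← map_mul, mul_inv_cancel, map_one, Module.End.one_apply]
  have hfwd : ∀ y, y ∈ Φ₁.twistedFil (p := p) (m := m) 1 →
      Θ (κ.eisensteinTwist ((W.baseChange K).torsionGaloisModule ((p : ℤ) ^ 1)) hm 1 (cd.δ v) y) ∈
        Φ₂.twistedFil (p := p) (m := m) 1 := by
    intro y hy
    induction hy using Submodule.span_induction with
    | mem y hy =>
      obtain ⟨c, a, ha, rfl⟩ := hy
      rw [eisensteinTwist_apply_tmul, hΘ]
      exact Φ₂.tmul_mem_twistedFil 1 _ ((hFil a).mp ha)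
    | zero => rw [map_zero, map_zero]; exact zero_mem _
    | add y z _ _ hy hz => rw [map_add, map_add]; exact add_mem hy hz
    | smul n y _ hy => rw [map_zsmul, map_zsmul]; exact Submodule.smul_mem _ n hy
  have hbwd : ∀ y, y ∈ Φ₂.twistedFil (p := p) (m := m) 1 →
      κ.eisensteinTwist ((W.baseChange K).torsionGaloisModule ((p : ℤ) ^ 1)) hm 1 (cd.δ v)⁻¹ (Θ y) ∈
        Φ₁.twistedFil (p := p) (m := m) 1 := by
    intro y hy
    induction hy using Submodule.span_induction with
    | mem y hy =>
      obtain ⟨c, a, ha, rfl⟩ := hy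
      rw [hΘ, eisensteinTwist_apply_tmul]
      refine Φ₁.tmul_mem_twistedFil 1 _ ((hFil _).mpr ?_)
      rw [hρρ, cd.isLift.torsionMap_torsionMap W hτ₂ _ a]
      exact ha
    | zero => rw [map_zero, map_zero]; exact zero_mem _
    | add y z _ _ hy hz => rw [map_add, map_add]; exact add_mem hy hz
    | smul n y _ hy => rw [map_zsmul, map_zsmul]; exact Submodule.smul_mem _ n hy
  refine ⟨hfwd x, fun hx ↦ ?_⟩
  have h := hbwd _ hx
  rwa [W.residualInvol_involutive cd hΘ hτ₂, ← Module.End.mul_apply, ← map_mul, inv_mul_cancel, map_one,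
    Module.End.one_apply] at h

include hΘ hτ₂ hanti in
/-- **`Ψ_v (H¹_str(K_{σv}, Fil_{σv} W₁)) = H¹_str(K_v, Fil_v W₁)`**: the bijection `Ψ_v = H¹(Θ₁) ∘ transport_v` carries the
strict ordinary condition of `W₁ = E[p] ⊗ A_{m,1}` at `σ v` onto the one at `v`, for plus parts corresponding under `τ ∘ δ_v`
(x9-p1-w3 g5's `ResidualTau.map_thetaH1_comp_transportH1_strictSubgroup_eq` for the `G_ℚ`-structure `Θ₁`, `R := ℤ`).
[cite: Howard2004HeegnerKolyvagin, §1.3 H.5(b) (arXiv p. 7 L96–97) and §3.2 (p. 16 L5–6: τ(Fil_w̄ T) = Fil_w T)]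
[cite: SerreGaloisCohomology1997, I §2.4 and §5.8] [cite: GreenbergLNM1716, §2] -/
theorem map_thetaH1_transportH1_strictSubgroup_twistedFil_eq (v : HeightOneSpectrum (𝓞 K))
    {t : ∀ k, ((W.baseChange K).torsionGaloisModule ((p : ℤ) ^ (k + 1))).toContRepresentation →ⁱL
      ((W.baseChange K).torsionGaloisModule ((p : ℤ) ^ k)).toContRepresentation}
    (Φ₁ : ZpExtension.OrdinaryFiltration (fun k ↦ (W.baseChange K).torsionGaloisModule ((p : ℤ) ^ k)) t (cd.σ • v))
    (Φ₂ : ZpExtension.OrdinaryFiltration (fun k ↦ (W.baseChange K).torsionGaloisModule ((p : ℤ) ^ k)) t v)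
    (hFil : ∀ a : geomTorsion (W.baseChange K) ((p : ℤ) ^ 1), a ∈ Φ₁.fil 1 ↔
      cd.isLift.torsionMap W ((p : ℤ) ^ 1) (((W.baseChange K).torsionGaloisModule ((p : ℤ) ^ 1)) (cd.δ v) a) ∈ Φ₂.fil 1) :
    AddSubgroup.map
        ((ContinuousRep.cohomologyMap
            ((cd.twist (κ.eisensteinTwist ((W.baseChange K).torsionGaloisModule ((p : ℤ) ^ 1)) hm 1)).toLocal (Sum.inr v))
            ((κ.eisensteinTwist ((W.baseChange K).torsionGaloisModule ((p : ℤ) ^ 1)) hm 1).toLocal (Sum.inr v))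
            Θ continuous_of_discreteTopology (W.residualInvol_compat_toLocal κ hm cd hΘ hanti v) 1).comp
          (cd.transportH1 (κ.eisensteinTwist ((W.baseChange K).torsionGaloisModule ((p : ℤ) ^ 1)) hm 1) v))
        (((κ.eisensteinTwist ((W.baseChange K).torsionGaloisModule ((p : ℤ) ^ 1)) hm 1).toLocal
            (Sum.inr (cd.σ • v))).strictSubgroup (Φ₁.twistedFil (p := p) (m := m) 1)
          (fun g _ hx ↦ Φ₁.twistedFil_le_comap hm 1 g hx)) =
      ((κ.eisensteinTwist ((W.baseChange K).torsionGaloisModule ((p : ℤ) ^ 1)) hm 1).toLocal (Sum.inr v)).strictSubgroup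
        (Φ₂.twistedFil (p := p) (m := m) 1) (fun g _ hx ↦ Φ₂.twistedFil_le_comap hm 1 g hx) := by
  let A₁ : ResidualTau (R := ℤ) cd (κ.eisensteinTwist ((W.baseChange K).torsionGaloisModule ((p : ℤ) ^ 1)) hm 1) :=
    ⟨Θ.toIntLinearMap, W.residualInvol_involutive cd hΘ hτ₂, fun g x ↦ W.residualInvol_compat κ hm cd hΘ hanti g x⟩
  exact ResidualTau.map_thetaH1_comp_transportH1_strictSubgroup_eq cd _ A₁ v _ _ _ _
    fun x ↦ W.mem_twistedFil_iff_residualInvol_delta_mem κ hm cd hΘ hτ₂ v Φ₁ Φ₂ hFil x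

/-! ## §2c Transport of the torsion cut `{y : [T]^r · y ∈ H¹_str(K_•, Fil_• W₁)}` -/

/-- If a bijective additive map `Ψ` carries `S₁` onto `S₂` and `Ψ ∘ s₁ = s₂ ∘ Ψ`, then `Ψ` carries `s₁⁻¹ S₁` onto
`s₂⁻¹ S₂`. [folklore] -/
private theorem map_comap_eq_comap_of_bijective {A B : Type*} [AddCommGroup A] [AddCommGroup B] (Ψ : A →+ B)
    (hΨ : Function.Bijective Ψ) {S₁ : AddSubgroup A} {S₂ : AddSubgroup B} (hS : S₁.map Ψ = S₂) (s₁ : A →+ A)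
    (s₂ : B →+ B) (hs : ∀ y, Ψ (s₁ y) = s₂ (Ψ y)) : (S₁.comap s₁).map Ψ = S₂.comap s₂ := by
  ext z
  constructor
  · rintro ⟨y, hy, rfl⟩
    rw [AddSubgroup.mem_comap, ← hs, ← hS]
    exact ⟨s₁ y, hy, rfl⟩
  · intro hz
    obtain ⟨y, rfl⟩ := hΨ.2 z
    refine ⟨y, ?_, rfl⟩
    rw [AddSubgroup.mem_comap, ← hs, ← hS] at hz
    obtain ⟨y', hy', hyy⟩ := hz
    rw [AddSubgroup.coe_comap, Set.mem_preimage, SetLike.mem_coe, ← hΨ.1 hyy]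
    exact hy'

/-- `(u·d)⁻¹ S = d⁻¹ S` on `H¹` for a unit scalar `u` and an `S` stable under all scalars. [folklore] -/
private theorem comap_scalarMapH1_unit_mul_eq {F : Type} [Field F] {M : Type} [AddCommGroup M] [TopologicalSpace M]
    [DiscreteTopology M] {R : Type*} [Ring R] [Module R M] (ρ : DiscreteGaloisModule F M) (hρ : ρ.IsScalarLinear R)
    (S : AddSubgroup (galoisCohomology ρ 1)) (hS : ∀ (r : R) x, x ∈ S → galoisCohomology.scalarMapH1 ρ hρ r x ∈ S)
    (u : Rˣ) (d : R) :
    S.comap (galoisCohomology.scalarMapH1 ρ hρ (↑u * d)) = S.comap (galoisCohomology.scalarMapH1 ρ hρ d) := by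
  ext x
  rw [AddSubgroup.mem_comap, AddSubgroup.mem_comap, galoisCohomology.scalarMapH1_mul, AddMonoidHom.comp_apply]
  refine ⟨fun h ↦ ?_, fun h ↦ hS _ _ h⟩
  have h' := hS (↑u⁻¹ : R) _ h
  rwa [← AddMonoidHom.comp_apply (galoisCohomology.scalarMapH1 ρ hρ (↑u⁻¹ : R)), ← galoisCohomology.scalarMapH1_mul,
    Units.inv_mul, galoisCohomology.scalarMapH1_one, AddMonoidHom.id_apply] at h'

include hΘ hτ₂ hanti in
/-- **`Ψ_v` carries the TORSION CUT at `σ v` onto the torsion cut at `v`**: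
`Ψ_v {y ∈ H¹(K_{σv}, W₁) : [T]^r · y ∈ H¹_str(K_{σv}, Fil_{σv} W₁)} = {y ∈ H¹(K_v, W₁) : [T]^r · y ∈ H¹_str(K_v, Fil_v W₁)}`
— `Ψ_v` is a bijection carrying the strict conditions onto each other and `Ψ_v ∘ H¹([T]^r •) = H¹(ι₁[T]^r •) ∘ Ψ_v` with
`ι₁[T]^r = u^r [T]^r`, `u` a unit, while `H¹_str` is an `A_{m,1}`-submodule.  This is the bottom-level H.5(b) input at the
places above `p` in the anomalous case, where `F̄_𝔮(w)` is the residual image of this cut rather than of `H¹_str` itself.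
[cite: Howard2004HeegnerKolyvagin, §1.3 H.5(b) (arXiv p. 7 L96–97), §3.1 (p. 15 L62–66) and §3.2 (p. 16 L5–6, L116–123)]
[cite: MazurTateTeitelbaum1986Invent, Ch. I §17] [cite: SerreGaloisCohomology1997, I §2.4 and §5.8] -/
theorem map_thetaH1_transportH1_torsionCut_eq (v : HeightOneSpectrum (𝓞 K))
    {t : ∀ k, ((W.baseChange K).torsionGaloisModule ((p : ℤ) ^ (k + 1))).toContRepresentation →ⁱL
      ((W.baseChange K).torsionGaloisModule ((p : ℤ) ^ k)).toContRepresentation}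
    (Φ₁ : ZpExtension.OrdinaryFiltration (fun k ↦ (W.baseChange K).torsionGaloisModule ((p : ℤ) ^ k)) t (cd.σ • v))
    (Φ₂ : ZpExtension.OrdinaryFiltration (fun k ↦ (W.baseChange K).torsionGaloisModule ((p : ℤ) ^ k)) t v)
    (hFil : ∀ a : geomTorsion (W.baseChange K) ((p : ℤ) ^ 1), a ∈ Φ₁.fil 1 ↔
      cd.isLift.torsionMap W ((p : ℤ) ^ 1) (((W.baseChange K).torsionGaloisModule ((p : ℤ) ^ 1)) (cd.δ v) a) ∈ Φ₂.fil 1)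
    (r : ℕ) :
    AddSubgroup.map
        ((ContinuousRep.cohomologyMap
            ((cd.twist (κ.eisensteinTwist ((W.baseChange K).torsionGaloisModule ((p : ℤ) ^ 1)) hm 1)).toLocal (Sum.inr v))
            ((κ.eisensteinTwist ((W.baseChange K).torsionGaloisModule ((p : ℤ) ^ 1)) hm 1).toLocal (Sum.inr v))
            Θ continuous_of_discreteTopology (W.residualInvol_compat_toLocal κ hm cd hΘ hanti v) 1).comp
          (cd.transportH1 (κ.eisensteinTwist ((W.baseChange K).torsionGaloisModule ((p : ℤ) ^ 1)) hm 1) v))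
        ((((κ.eisensteinTwist ((W.baseChange K).torsionGaloisModule ((p : ℤ) ^ 1)) hm 1).toLocal
            (Sum.inr (cd.σ • v))).strictSubgroup (Φ₁.twistedFil (p := p) (m := m) 1)
          (fun g _ hx ↦ Φ₁.twistedFil_le_comap hm 1 g hx)).comap
          (galoisCohomology.scalarMapH1 _
            ((κ.isScalarLinear_eisensteinTwist ((W.baseChange K).torsionGaloisModule ((p : ℤ) ^ 1)) hm 1).restrictField _)
            ((Ideal.Quotient.mk _ PowerSeries.X : EisensteinCoeff p m 1) ^ r))) =
      (((κ.eisensteinTwist ((W.baseChange K).torsionGaloisModule ((p : ℤ) ^ 1)) hm 1).toLocal (Sum.inr v)).strictSubgroup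
        (Φ₂.twistedFil (p := p) (m := m) 1) (fun g _ hx ↦ Φ₂.twistedFil_le_comap hm 1 g hx)).comap
        (galoisCohomology.scalarMapH1 _
          ((κ.isScalarLinear_eisensteinTwist ((W.baseChange K).torsionGaloisModule ((p : ℤ) ^ 1)) hm 1).restrictField _)
          ((Ideal.Quotient.mk _ PowerSeries.X : EisensteinCoeff p m 1) ^ r)) := by
  have hS := W.map_thetaH1_transportH1_strictSubgroup_twistedFil_eq κ hm cd hΘ hτ₂ hanti v Φ₁ Φ₂ hFil
  have hstab : ∀ (d : EisensteinCoeff p m 1) x,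
      x ∈ ((κ.eisensteinTwist ((W.baseChange K).torsionGaloisModule ((p : ℤ) ^ 1)) hm 1).toLocal (Sum.inr v)).strictSubgroup
        (Φ₂.twistedFil (p := p) (m := m) 1) (fun g _ hx ↦ Φ₂.twistedFil_le_comap hm 1 g hx) →
      galoisCohomology.scalarMapH1 _
        ((κ.isScalarLinear_eisensteinTwist ((W.baseChange K).torsionGaloisModule ((p : ℤ) ^ 1)) hm 1).restrictField _) d x ∈
      ((κ.eisensteinTwist ((W.baseChange K).torsionGaloisModule ((p : ℤ) ^ 1)) hm 1).toLocal (Sum.inr v)).strictSubgroup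
        (Φ₂.twistedFil (p := p) (m := m) 1) (fun g _ hx ↦ Φ₂.twistedFil_le_comap hm 1 g hx) :=
    fun d _ hx ↦ DiscreteGaloisModule.scalarMapH1_mem_strictSubgroup _ _ _ d (fun _ hw ↦ Φ₂.smul_mem_twistedFil 1 d hw) hx
  refine (map_comap_eq_comap_of_bijective _ (W.thetaH1_transportH1_bijective κ hm cd hΘ hτ₂ hanti v) hS _ _
    (fun y ↦ W.thetaH1_transportH1_scalarMapH1 κ hm cd hΘ hanti v _ y)).trans ?_
  rw [EisensteinCoeff.invol₁_mk_X_pow, ← Units.val_pow_eq_pow_val]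
  exact comap_scalarMapH1_unit_mul_eq _ _ _ hstab _ _

/-! ## §3 Compatibility with a residual presentation `π̄ : W₁ → E[p]`, `π̄ (d ⊗ a) = ε(d) a` -/

include hΘ in
/-- **`π̄ ∘ Θ₁ = θ ∘ π̄`** for any additive `π̄ : W₁ → E[p]` with `π̄ (d ⊗ a) = ε(d) · a` (`ε` the residue character of
`A_{m,1}`; the tree's `eisensteinDVRSetting….πbar 0`) and `θ = τ_*` on `E[p]`: `ε ∘ ι₁ = ε` (`residueChar_invol₁_eq`).
[cite: Howard2004HeegnerKolyvagin, §1.3 H.5(a) (arXiv p. 7 L93–95) and §2.1 (proof of Prop. 2.1.3: T̄ = E[p] ⊗ S_𝔭/𝔪)]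
[cite: MazurTateTeitelbaum1986Invent, Ch. I §17] -/
theorem πbar_residualInvol
    (πb : EisensteinCoeff.Twisted p m 1 (geomTorsion (W.baseChange K) ((p : ℤ) ^ 1)) →+ geomTorsion (W.baseChange K) (p : ℤ))
    (hπb : ∀ (d : EisensteinCoeff p m 1) (a : geomTorsion (W.baseChange K) ((p : ℤ) ^ 1)),
      ((πb (EisensteinCoeff.Twisted.tmul d a) : geomTorsion (W.baseChange K) (p : ℤ)) : geomPoints (W.baseChange K)) =
        (EisensteinCoeff.residueChar p hm (le_refl 1) d).val • (a : geomPoints (W.baseChange K)))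
    (x : EisensteinCoeff.Twisted p m 1 (geomTorsion (W.baseChange K) ((p : ℤ) ^ 1))) :
    πb (Θ x) = cd.isLift.torsionMap W (p : ℤ) (πb x) := by
  induction x using EisensteinCoeff.Twisted.induction_on with
  | zero => rw [map_zero, map_zero, map_zero]
  | tmul d a =>
    apply Subtype.ext
    rw [hΘ, hπb, IsLiftOfAut.coe_torsionMap, IsLiftOfAut.coe_torsionMap, hπb, map_nsmul,
      EisensteinCoeff.residueChar_invol₁_eq]
  | add x y hx hy => rw [map_add, map_add, hx, hy, map_add, map_add]

include hΘ hanti in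
/-- **`H¹(π̄)_v ∘ Ψ_v = (θ_v ∘ transport_v) ∘ H¹(π̄)_{σv}`** on `H¹(K_{σv}, W₁)`: for a `Γ_K`-equivariant additive
`π̄ : W₁ → E[p]` with `π̄ ∘ Θ₁ = θ ∘ π̄` and a `G_ℚ`-structure `θ` on `E[p]` given by `τ_*` (any coefficient ring; the tree's
`residualTauGeomTorsion`), the bijection `Ψ_v` of `W₁` covers the H.5(b) map `θ_v ∘ transport_v` of `T̄ = E[p]`
(naturality of the transport, `ConjugationDatum.transportH1_map_localMap`, and functoriality of `H¹`).
[cite: Howard2004HeegnerKolyvagin, §1.3 H.5(b) (arXiv p. 7 L44–50, L96–97)] [cite: SerreGaloisCohomology1997, I §2.4 (compatible pairs)] -/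
theorem cohomologyMap_πbar_thetaH1_transportH1 (v : HeightOneSpectrum (𝓞 K)) {R' : Type} [CommRing R']
    [Module R' (geomTorsion (W.baseChange K) (p : ℤ))]
    (AE : ResidualTau (R := R') cd ((W.baseChange K).torsionGaloisModule (p : ℤ)))
    (hAE : ∀ a, AE.θ a = cd.isLift.torsionMap W (p : ℤ) a)
    (πb : EisensteinCoeff.Twisted p m 1 (geomTorsion (W.baseChange K) ((p : ℤ) ^ 1)) →+ geomTorsion (W.baseChange K) (p : ℤ))
    (hπbΘ : ∀ x, πb (Θ x) = cd.isLift.torsionMap W (p : ℤ) (πb x))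
    (hπbG : ∀ (g : absoluteGaloisGroup K) (x : EisensteinCoeff.Twisted p m 1 (geomTorsion (W.baseChange K) ((p : ℤ) ^ 1))),
      πb (κ.eisensteinTwist ((W.baseChange K).torsionGaloisModule ((p : ℤ) ^ 1)) hm 1 g x) =
        ((W.baseChange K).torsionGaloisModule (p : ℤ)) g (πb x))
    (y : galoisCohomology ((κ.eisensteinTwist ((W.baseChange K).torsionGaloisModule ((p : ℤ) ^ 1)) hm 1).toLocal
      (Sum.inr (cd.σ • v))) 1) :
    ContinuousRep.cohomologyMap
        ((κ.eisensteinTwist ((W.baseChange K).torsionGaloisModule ((p : ℤ) ^ 1)) hm 1).toLocal (Sum.inr v))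
        (((W.baseChange K).torsionGaloisModule (p : ℤ)).toLocal (Sum.inr v)) πb continuous_of_discreteTopology
        (fun _ x ↦ hπbG _ x) 1
        (ContinuousRep.cohomologyMap
          ((cd.twist (κ.eisensteinTwist ((W.baseChange K).torsionGaloisModule ((p : ℤ) ^ 1)) hm 1)).toLocal (Sum.inr v))
          ((κ.eisensteinTwist ((W.baseChange K).torsionGaloisModule ((p : ℤ) ^ 1)) hm 1).toLocal (Sum.inr v))
          Θ continuous_of_discreteTopology (W.residualInvol_compat_toLocal κ hm cd hΘ hanti v) 1
          (cd.transportH1 (κ.eisensteinTwist ((W.baseChange K).torsionGaloisModule ((p : ℤ) ^ 1)) hm 1) v y)) =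
      AE.thetaH1 (Sum.inr v)
        (cd.transportH1 ((W.baseChange K).torsionGaloisModule (p : ℤ)) v
          (ContinuousRep.cohomologyMap
            ((κ.eisensteinTwist ((W.baseChange K).torsionGaloisModule ((p : ℤ) ^ 1)) hm 1).toLocal (Sum.inr (cd.σ • v)))
            (((W.baseChange K).torsionGaloisModule (p : ℤ)).toLocal (Sum.inr (cd.σ • v))) πb continuous_of_discreteTopology
            (fun _ x ↦ hπbG _ x) 1 y)) := by
  -- the global intertwining map underlying `π̄` and its local `H¹`-maps
  let πbI : (κ.eisensteinTwist ((W.baseChange K).torsionGaloisModule ((p : ℤ) ^ 1)) hm 1).toContRepresentation →ⁱL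
      ((W.baseChange K).torsionGaloisModule (p : ℤ)).toContRepresentation :=
    { toContinuousLinearMap := ⟨πb.toIntLinearMap, continuous_of_discreteTopology⟩
      isIntertwining' := fun g ↦ ContinuousLinearMap.ext fun x ↦ hπbG g x }
  have hπv : ∀ w : HeightOneSpectrum (𝓞 K),
      ContinuousRep.cohomologyMap
          ((κ.eisensteinTwist ((W.baseChange K).torsionGaloisModule ((p : ℤ) ^ 1)) hm 1).toLocal (Sum.inr w))
          (((W.baseChange K).torsionGaloisModule (p : ℤ)).toLocal (Sum.inr w)) πb continuous_of_discreteTopology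
          (fun _ x ↦ hπbG _ x) 1 =
        galoisCohomology.map (Literature.NumberTheory.EllipticCurves.DiscreteGaloisModule.localMap πbI (Sum.inr w)) 1 :=
    fun w ↦ cohomologyMap_one_eq_map _ _ πb _ _ _ (fun _ ↦ rfl)
  -- `H¹(Θ₁)` and `θ_v` as `galoisCohomology.map`
  let ΘI : ((cd.twist (κ.eisensteinTwist ((W.baseChange K).torsionGaloisModule ((p : ℤ) ^ 1)) hm 1)).toLocal
        (Sum.inr v)).toContRepresentation →ⁱL
      ((κ.eisensteinTwist ((W.baseChange K).torsionGaloisModule ((p : ℤ) ^ 1)) hm 1).toLocal (Sum.inr v)).toContRepresentation :=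
    { toContinuousLinearMap := ⟨Θ.toIntLinearMap, continuous_of_discreteTopology⟩
      isIntertwining' := fun g ↦ ContinuousLinearMap.ext fun x ↦ W.residualInvol_compat_toLocal κ hm cd hΘ hanti v g x }
  have hΘI : ContinuousRep.cohomologyMap
      ((cd.twist (κ.eisensteinTwist ((W.baseChange K).torsionGaloisModule ((p : ℤ) ^ 1)) hm 1)).toLocal (Sum.inr v))
      ((κ.eisensteinTwist ((W.baseChange K).torsionGaloisModule ((p : ℤ) ^ 1)) hm 1).toLocal (Sum.inr v))
      Θ continuous_of_discreteTopology (W.residualInvol_compat_toLocal κ hm cd hΘ hanti v) 1 = galoisCohomology.map ΘI 1 :=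
    cohomologyMap_one_eq_map _ _ Θ _ _ ΘI (fun _ ↦ rfl)
  let θI : ((cd.twist ((W.baseChange K).torsionGaloisModule (p : ℤ))).toLocal (Sum.inr v)).toContRepresentation →ⁱL
      (((W.baseChange K).torsionGaloisModule (p : ℤ)).toLocal (Sum.inr v)).toContRepresentation :=
    { toContinuousLinearMap := ⟨AE.θ.toAddMonoidHom.toIntLinearMap, continuous_of_discreteTopology⟩
      isIntertwining' := fun g ↦ ContinuousLinearMap.ext fun x ↦ AE.compat _ x }
  have hθI : AE.thetaH1 (Sum.inr v) = galoisCohomology.map θI 1 :=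
    cohomologyMap_one_eq_map _ _ AE.θ.toAddMonoidHom _ _ θI (fun _ ↦ rfl)
  -- `Tw(π̄)` at `v`
  let πtw : ((cd.twist (κ.eisensteinTwist ((W.baseChange K).torsionGaloisModule ((p : ℤ) ^ 1)) hm 1)).toLocal
        (Sum.inr v)).toContRepresentation →ⁱL
      ((cd.twist ((W.baseChange K).torsionGaloisModule (p : ℤ))).toLocal (Sum.inr v)).toContRepresentation :=
    Literature.NumberTheory.EllipticCurves.DiscreteGaloisModule.localMap
      (Literature.NumberTheory.EllipticCurves.DiscreteGaloisModule.restrictMap πbI cd.conj) (Sum.inr v)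
  rw [hπv v, hπv (cd.σ • v), hΘI, hθI]
  change galoisCohomology.map (Literature.NumberTheory.EllipticCurves.DiscreteGaloisModule.localMap πbI (Sum.inr v)) 1
      (galoisCohomology.map ΘI 1
        (cd.transportH1 (κ.eisensteinTwist ((W.baseChange K).torsionGaloisModule ((p : ℤ) ^ 1)) hm 1) v y)) =
    galoisCohomology.map θI 1 (cd.transportH1 ((W.baseChange K).torsionGaloisModule (p : ℤ)) v
      (galoisCohomology.map (Literature.NumberTheory.EllipticCurves.DiscreteGaloisModule.localMap πbI (Sum.inr (cd.σ • v))) 1 y))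
  rw [cd.transportH1_map_localMap _ _ πbI v y]
  change galoisCohomology.map _ 1 (galoisCohomology.map ΘI 1 _) = galoisCohomology.map θI 1 (galoisCohomology.map πtw 1 _)
  have hpt : ∀ x, ((Literature.NumberTheory.EllipticCurves.DiscreteGaloisModule.localMap πbI (Sum.inr v)).comp ΘI) x =
      (θI.comp πtw) x := fun x ↦ by
    change πb (Θ x) = AE.θ (πb x)
    rw [hπbΘ, hAE]
  exact (galoisCohomology.map_map_of_comp_apply ΘI _
      ((Literature.NumberTheory.EllipticCurves.DiscreteGaloisModule.localMap πbI (Sum.inr v)).comp ΘI) (fun _ ↦ rfl) _).trans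
    ((galoisCohomology.map_congr_apply _ _ hpt _).trans
      (galoisCohomology.map_map_of_comp_apply πtw θI (θI.comp πtw) (fun _ ↦ rfl) _).symm)


include hΘ hanti in
/-- **Subgroup form of the previous theorem**: for `X ≤ H¹(K_{σv}, W₁)`,
`H¹(π̄)_v (Ψ_v X) = (θ_v ∘ transport_v) (H¹(π̄)_{σv} X)` — with `X` the torsion cut and `F̄_𝔮(w) = H¹(π̄)_w (cut_w)` this is
the H.5(b) clause `(θ_v ∘ transport_v)(F̄_𝔮(σ v)) = F̄_𝔮(v)` once `Ψ_v (cut_{σv}) = cut_v`.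
[cite: Howard2004HeegnerKolyvagin, §1.3 H.5(b) (arXiv p. 7 L44–50, L96–97)] [cite: SerreGaloisCohomology1997, I §2.4 (compatible pairs)] -/
theorem map_cohomologyMap_πbar_thetaH1_transportH1 (v : HeightOneSpectrum (𝓞 K)) {R' : Type} [CommRing R']
    [Module R' (geomTorsion (W.baseChange K) (p : ℤ))]
    (AE : ResidualTau (R := R') cd ((W.baseChange K).torsionGaloisModule (p : ℤ)))
    (hAE : ∀ a, AE.θ a = cd.isLift.torsionMap W (p : ℤ) a)
    (πb : EisensteinCoeff.Twisted p m 1 (geomTorsion (W.baseChange K) ((p : ℤ) ^ 1)) →+ geomTorsion (W.baseChange K) (p : ℤ))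
    (hπbΘ : ∀ x, πb (Θ x) = cd.isLift.torsionMap W (p : ℤ) (πb x))
    (hπbG : ∀ (g : absoluteGaloisGroup K) (x : EisensteinCoeff.Twisted p m 1 (geomTorsion (W.baseChange K) ((p : ℤ) ^ 1))),
      πb (κ.eisensteinTwist ((W.baseChange K).torsionGaloisModule ((p : ℤ) ^ 1)) hm 1 g x) =
        ((W.baseChange K).torsionGaloisModule (p : ℤ)) g (πb x))
    (X : AddSubgroup (galoisCohomology ((κ.eisensteinTwist ((W.baseChange K).torsionGaloisModule ((p : ℤ) ^ 1)) hm 1).toLocal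
      (Sum.inr (cd.σ • v))) 1)) :
    (X.map ((ContinuousRep.cohomologyMap
          ((cd.twist (κ.eisensteinTwist ((W.baseChange K).torsionGaloisModule ((p : ℤ) ^ 1)) hm 1)).toLocal (Sum.inr v))
          ((κ.eisensteinTwist ((W.baseChange K).torsionGaloisModule ((p : ℤ) ^ 1)) hm 1).toLocal (Sum.inr v))
          Θ continuous_of_discreteTopology (W.residualInvol_compat_toLocal κ hm cd hΘ hanti v) 1).comp
        (cd.transportH1 (κ.eisensteinTwist ((W.baseChange K).torsionGaloisModule ((p : ℤ) ^ 1)) hm 1) v))).map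
      (ContinuousRep.cohomologyMap
        ((κ.eisensteinTwist ((W.baseChange K).torsionGaloisModule ((p : ℤ) ^ 1)) hm 1).toLocal (Sum.inr v))
        (((W.baseChange K).torsionGaloisModule (p : ℤ)).toLocal (Sum.inr v)) πb continuous_of_discreteTopology
        (fun _ x ↦ hπbG _ x) 1) =
    (X.map (ContinuousRep.cohomologyMap
        ((κ.eisensteinTwist ((W.baseChange K).torsionGaloisModule ((p : ℤ) ^ 1)) hm 1).toLocal (Sum.inr (cd.σ • v)))
        (((W.baseChange K).torsionGaloisModule (p : ℤ)).toLocal (Sum.inr (cd.σ • v))) πb continuous_of_discreteTopology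
        (fun _ x ↦ hπbG _ x) 1)).map
      ((AE.thetaH1 (Sum.inr v)).comp (cd.transportH1 ((W.baseChange K).torsionGaloisModule (p : ℤ)) v)) := by
  ext z
  constructor
  · rintro ⟨x, ⟨y, hy, rfl⟩, rfl⟩
    exact ⟨_, ⟨y, hy, rfl⟩, (W.cohomologyMap_πbar_thetaH1_transportH1 κ hm cd hΘ hanti v AE hAE πb hπbΘ hπbG y).symm⟩
  · rintro ⟨x, ⟨y, hy, rfl⟩, rfl⟩
    exact ⟨_, ⟨y, hy, rfl⟩, W.cohomologyMap_πbar_thetaH1_transportH1 κ hm cd hΘ hanti v AE hAE πb hπbΘ hπbG y⟩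

end WeierstrassCurve

end
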